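import Summits.Ventures.QEC.Census.CertInfoSetOrbitStabCert
import HarnessLib

/-!
# Orbit-STABILIZED information sets — the FAST structural check of a stabilized view (qec-search-4 g6)

`StabView.stabOK` (`Census/CertInfoSetOrbitStab.lean`) checks each mover of a stabilized view by tabulating its word
(`wordPerm`: one `composeTab` per letter, `O(n²)` list look-ups) and reading the table at every qubit — ≈ 140 s in the
kernel for ONE view at `n = 252`.  This file checks the SAME facts with qec-type-12's bit-mask transport `wordApplyL`
(one `permWordL` pass per letter): per `F`-column `x`, `σ(2^x) = 2^b` (the mover maps `x` to its base point),
`σ(M) = M` (the column set `F` is invariant) and `σ(O_j) = O_j` for every orbit mask `O_j` (labels are preserved on `F`)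
— `StabView.moverOKF` / `StabView.stabOKF`; `stabOKF_spec` extracts the facts; `maskCovers_of_stabF` = the landed
`maskCovers_of_stab` argument on those facts; `DistCert.maskCoversZ_of_stabF` / `maskCoversX_of_stabF` are the shapes an
emitted row proves.  HONEST FRAMING: infrastructure — no certificate is read and no distance is asserted; tier KERNEL, axioms
⊆ {propext, Classical.choice, Quot.sound}; no `native_decide`. [folklore]
-/

set_option autoImplicit false

namespace Summit.Ventures.QEC.Census

open Matrix Literature.InformationTheory.QuantumCodes

namespace StabView

variable (v : StabView)

/-- The orbit mask of label `j`: the `F`-columns `y < n` with `orb y = j`, as a bitmask. (definition) -/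
def orbMaskOf (n j : ℕ) : ℕ := maskOf ((List.range n).filter fun y => v.mask.testBit y && (v.orb.getD y 0 == j))

/-- **The fast mover check of an `F`-column `x`** (bit-mask transports, type-12 `wordApplyL`): label `j < norb`, base
point `b = base[j]` a free column `< n`; the mover word maps `2^x ↦ 2^b`, `F ↦ F` and every orbit mask onto itself.
(definition) -/
def moverOKF (n : ℕ) (gens : List (List ℕ)) (x : ℕ) : Bool :=
  decide (v.orb.getD x 0 < v.norb) && decide (v.base.getD (v.orb.getD x 0) 0 < n) &&
    !(v.ic.piv.elem (v.base.getD (v.orb.getD x 0) 0)) &&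
    (wordApplyL n gens (v.mv.getD x []) (2 ^ x) == 2 ^ (v.base.getD (v.orb.getD x 0) 0)) &&
    (wordApplyL n gens (v.mv.getD x []) v.mask == v.mask) &&
    (List.range v.norb).all fun j => wordApplyL n gens (v.mv.getD x []) (v.orbMaskOf n j) == v.orbMaskOf n j

/-- **The fast structural check of a stabilized view**: mover words name generators; every free column `< n` is in
`F`; every `F`-column `< n` passes `moverOKF`. (definition, `decide +kernel`) -/
def stabOKF (n : ℕ) (gens : List (List ℕ)) (ngens : ℕ) : Bool :=
  autWordsOK ngens v.mv &&
    (List.range n).all fun x =>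
      (!(isFree v.ic.piv x) || v.mask.testBit x) && (!(v.mask.testBit x) || v.moverOKF n gens x)

/-- Bits of an orbit mask. -/
theorem testBit_orbMaskOf (n j y : ℕ) :
    (v.orbMaskOf n j).testBit y = true ↔ y < n ∧ v.mask.testBit y = true ∧ v.orb.getD y 0 = j := by
  rw [orbMaskOf, testBit_maskOf]
  simp [List.mem_filter, List.mem_range]

/-- **Unpacking the fast check**: the word check, `free ⊆ F`, and per `F`-column the mover facts stated for the
permutation `σ = wordEquiv n gens (mv x)` itself. -/
theorem stabOKF_spec {n : ℕ} {gens : List (List ℕ)} {ngens : ℕ} (hgens : ∀ g ∈ gens, permListOK n g = true)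
    (hng : ngens = gens.length) (h : v.stabOKF n gens ngens = true) :
    autWordsOK ngens v.mv = true ∧
      (∀ x, x < n → isFree v.ic.piv x = true → v.mask.testBit x = true) ∧
      (∀ x (hx : x < n), v.mask.testBit x = true →
        v.orb.getD x 0 < v.norb ∧ v.base.getD (v.orb.getD x 0) 0 < n ∧
        v.ic.piv.elem (v.base.getD (v.orb.getD x 0) 0) = false ∧
        ((wordEquiv n gens (v.mv.getD x []) ⟨x, hx⟩ : Fin n) : ℕ) = v.base.getD (v.orb.getD x 0) 0 ∧
        (∀ y : Fin n, v.mask.testBit (wordEquiv n gens (v.mv.getD x []) y) = v.mask.testBit y) ∧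
        (∀ y : Fin n, v.mask.testBit y = true →
          v.orb.getD (wordEquiv n gens (v.mv.getD x []) y) 0 = v.orb.getD y 0)) := by
  simp only [stabOKF, Bool.and_eq_true, List.all_eq_true, List.mem_range, Bool.or_eq_true, Bool.not_eq_true'] at h
  obtain ⟨hw, hall⟩ := h
  have hfreeF : ∀ x, x < n → isFree v.ic.piv x = true → v.mask.testBit x = true := fun x hx hf => by
    rcases (hall x hx).1 with h | h
    · rw [hf] at h; exact absurd h (by decide)
    · exact h
  refine ⟨hw, hfreeF, fun x hx hxM => ?_⟩
  have hm : v.moverOKF n gens x = true := by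
    rcases (hall x hx).2 with h | h
    · rw [hxM] at h; exact absurd h (by decide)
    · exact h
  simp only [moverOKF, Bool.and_eq_true, decide_eq_true_eq, Bool.not_eq_true', beq_iff_eq, List.all_eq_true,
    List.mem_range] at hm
  obtain ⟨⟨⟨⟨⟨hj, hbn⟩, hbfree⟩, hx2b⟩, hMM⟩, hOO⟩ := hm
  set wd := v.mv.getD x [] with hwd
  have hwdlt : ∀ g ∈ wd, g < gens.length := by
    intro g hg
    by_cases hxl : x < v.mv.length
    · have hval : wd = v.mv[x] := by
        rw [hwd, List.getD_eq_getElem?_getD, List.getElem?_eq_getElem hxl, Option.getD_some]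
      rw [hval] at hg
      exact hng ▸ lt_of_autWordsOK hw (List.getElem_mem hxl) g hg
    · rw [hwd, List.getD_eq_getElem?_getD, List.getElem?_eq_none (not_lt.1 hxl), Option.getD_none] at hg
      simp at hg
  set σ := wordEquiv n gens wd with hσ
  have hbit := testBit_wordApplyL hgens wd hwdlt
  -- (1) the mover maps `x` to `b`
  have hσx : ((σ ⟨x, hx⟩ : Fin n) : ℕ) = v.base.getD (v.orb.getD x 0) 0 := by
    have h1 : (wordApplyL n gens wd (2 ^ x)).testBit (v.base.getD (v.orb.getD x 0) 0) = true := by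
      rw [hx2b, Nat.testBit_two_pow_self]
    obtain ⟨q, hq, hqb⟩ := (hbit _ _).1 h1
    rw [Nat.testBit_two_pow] at hq
    have hxq : x = (q : ℕ) := by simpa using hq
    have : q = ⟨x, hx⟩ := Fin.ext hxq.symm
    rw [← this]; exact hqb
  -- (2) `F` is invariant
  have hMinv : ∀ y : Fin n, v.mask.testBit (σ y) = v.mask.testBit y := by
    intro y
    cases hy : v.mask.testBit y
    · by_contra hc
      rw [Bool.not_eq_false] at hc
      rw [← hMM] at hc
      obtain ⟨q, hq, hqy⟩ := (hbit _ _).1 hc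
      have : q = y := σ.injective (Fin.ext hqy)
      rw [this, hy] at hq; exact absurd hq (by decide)
    · have : (wordApplyL n gens wd v.mask).testBit (σ y) = true := (hbit _ _).2 ⟨y, hy, rfl⟩
      rwa [hMM] at this
  -- (3) labels are preserved on `F`
  have horb : ∀ y : Fin n, v.mask.testBit y = true → v.orb.getD (σ y) 0 = v.orb.getD y 0 := by
    intro y hyM
    have hjy : v.orb.getD y 0 < v.norb := by
      rcases (hall y y.2).2 with h | h
      · rw [hyM] at h; exact absurd h (by decide)
      · simp only [moverOKF, Bool.and_eq_true, decide_eq_true_eq] at h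
        exact h.1.1.1.1.1
    have hyO : (v.orbMaskOf n (v.orb.getD y 0)).testBit y = true :=
      (v.testBit_orbMaskOf n _ y).2 ⟨y.2, hyM, rfl⟩
    have h1 : (wordApplyL n gens wd (v.orbMaskOf n (v.orb.getD y 0))).testBit (σ y) = true :=
      (hbit _ _).2 ⟨y, hyO, rfl⟩
    rw [hOO _ hjy] at h1
    exact ((v.testBit_orbMaskOf n _ _).1 h1).2.2
  exact ⟨hj, hbn, hbfree, hσx, hMinv, horb⟩

end StabView

/-! ## Soundness: the fast check discharges `MaskCovers` (the argument of `maskCovers_of_stab`) -/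

section Sound

variable {n : ℕ} {Hsyn Hstab : List ℕ}

/-- **A stabilized view's canonical families discharge `MaskCovers` — fast structural check.**  Identical to the landed
`maskCovers_of_stab`, with the mover facts read from `StabView.stabOKF_spec`. -/
theorem maskCovers_of_stabF (hcomm : rowMatrix n Hsyn * (rowMatrix n Hstab)ᵀ = 0) {found : List (ℕ × List ℕ)}
    (hfound : foundOK Hstab found = true)
    {gens : List AutGen} (hgens : autGensOK n Hsyn Hstab gens = true)
    (v : StabView) (hI : infoSetStructOK n Hsyn v.ic = true)
    (hv : v.stabOKF n (autPerms gens) gens.length = true) {wmax : ℕ}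
    (hfam : 0 < v.t → ∀ j, j < v.norb →
      TopReaches (bzLeaf wmax (found.map Prod.fst)) (v.canonRows n j) (v.baseRow j) (v.t - 1)) :
    MaskCovers n Hsyn Hstab wmax v.mask v.t := by
  intro z hz1 hz2 hcnt
  have hperm : ∀ g ∈ autPerms gens, permListOK n g = true := permListOK_of_autGensOK hgens
  obtain ⟨hwords, hfreeF, hmov⟩ := v.stabOKF_spec hperm (List.length_map ..).symm hv
  have hI' := hI
  simp only [infoSetStructOK, Bool.and_eq_true] at hI'
  -- (a) the free support of `z` is nonempty; an `F`-point of the support with minimal label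
  have hdec0 := eq_ofBits_freeSupp (Hsyn := Hsyn) hI'.1 hI'.2 hz1
  have hne : freeSupp n v.ic.piv z ≠ [] := by
    intro he
    rw [he, List.map_nil, xorList, ofBits_zero] at hdec0
    exact hz2 (hdec0 ▸ Submodule.zero_mem _)
  obtain ⟨y0, hy0⟩ := List.exists_mem_of_ne_nil _ hne
  set LF := (suppIdx n z).filter (fun y => v.mask.testBit y) with hLF
  have hy0LF : y0 ∈ LF := by
    rw [hLF, List.mem_filter]
    refine ⟨List.mem_of_mem_filter hy0, hfreeF y0 (lt_of_mem_freeSupp z hy0) ?_⟩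
    rw [isFree, free_of_mem_freeSupp z hy0]; rfl
  obtain ⟨x, hxLF, hxmin⟩ :=
    LF.toFinset.exists_min_image (fun y => v.orb.getD y 0) ⟨y0, List.mem_toFinset.2 hy0LF⟩
  rw [List.mem_toFinset] at hxLF
  have hxsupp : x ∈ suppIdx n z := List.mem_of_mem_filter hxLF
  have hxM : v.mask.testBit x = true := by have := (List.mem_filter.1 hxLF).2; simpa using this
  have hxn : x < n := lt_of_mem_suppIdx n z hxsupp
  have hzx : z ⟨x, hxn⟩ ≠ 0 := (mem_suppIdx_iff n z ⟨x, hxn⟩).1 hxsupp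
  -- (b) the mover of `x`
  obtain ⟨hj, hbn, hbfree, hσxv, hMinv, horbinv⟩ := hmov x hxn hxM
  have hwdlt : ∀ g ∈ v.mv.getD x [], g < gens.length := by
    intro g hg
    by_cases hxl : x < v.mv.length
    · have hval : v.mv.getD x [] = v.mv[x] := by
        rw [List.getD_eq_getElem?_getD, List.getElem?_eq_getElem hxl, Option.getD_some]
      rw [hval] at hg
      exact lt_of_autWordsOK hwords (List.getElem_mem hxl) g hg
    · rw [List.getD_eq_getElem?_getD, List.getElem?_eq_none (not_lt.1 hxl), Option.getD_none] at hg
      simp at hg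
  set σ := wordEquiv n (autPerms gens) (v.mv.getD x []) with hσ
  obtain ⟨hz1', hz2', hz3'⟩ := orbit_transport hcomm hgens hwdlt z hz1 hz2
  set z' := z ∘ σ.symm with hz'
  set j := v.orb.getD x 0 with hjdef
  set b := v.base.getD j 0 with hbdef
  have hσx : σ ⟨x, hxn⟩ = ⟨b, hbn⟩ := Fin.ext hσxv
  -- (c) the base point is in the free support of `z'`
  have hbz' : z' ⟨b, hbn⟩ ≠ 0 := by
    show z (σ.symm ⟨b, hbn⟩) ≠ 0
    rw [← hσx, Equiv.symm_apply_apply]; exact hzx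
  have hbmem : b ∈ freeSupp n v.ic.piv z' := (mem_freeSupp_iff z' ⟨b, hbn⟩).2 ⟨hbz', hbfree⟩
  -- (d) every free support point of `z'` has label `≥ j`
  have hlab : ∀ y' ∈ freeSupp n v.ic.piv z', j ≤ v.orb.getD y' 0 := by
    intro y' hy'
    have hy'n := lt_of_mem_freeSupp z' hy'
    obtain ⟨hzy', hy'free⟩ := (mem_freeSupp_iff z' ⟨y', hy'n⟩).1 hy'
    have hy'M : v.mask.testBit y' = true := hfreeF y' hy'n (by rw [isFree, hy'free]; rfl)
    set y := σ.symm ⟨y', hy'n⟩ with hy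
    have hσy : σ y = ⟨y', hy'n⟩ := by rw [hy, Equiv.apply_symm_apply]
    have hyM : v.mask.testBit y = true := by rw [← hMinv y, hσy]; exact hy'M
    have hyLF : (y : ℕ) ∈ LF := by
      rw [hLF, List.mem_filter]
      exact ⟨(mem_suppIdx_iff n z y).2 hzy', by simpa using hyM⟩
    have := hxmin y (List.mem_toFinset.2 hyLF)
    rw [← horbinv y hyM, hσy] at this
    exact this
  -- (e) the free support of `z'` has `≤ t` elements, so `t ≥ 1`
  let f : ℕ → ℕ := fun q => if h : q < n then ((σ ⟨q, h⟩ : Fin n) : ℕ) else 0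
  have hf : ∀ q : Fin n, f q = ((σ q : Fin n) : ℕ) := fun q => by simp [f, q.2]
  have hlen : (freeSupp n v.ic.piv z').length ≤ v.t := by
    have h1 : (freeSupp n v.ic.piv z').length ≤ countB (fun y => v.mask.testBit y) (suppIdx n z') := by
      rw [← length_filter_eq_countB]
      have heq : freeSupp n v.ic.piv z' = (freeSupp n v.ic.piv z').filter fun y => v.mask.testBit y := by
        refine (List.filter_eq_self.2 fun y hy => ?_).symm
        exact hfreeF y (lt_of_mem_freeSupp z' hy) (by rw [isFree, free_of_mem_freeSupp z' hy]; rfl)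
      rw [heq]
      exact (List.filter_sublist.filter _).length_le
    have h2 : countB (fun y => v.mask.testBit y) (suppIdx n z') =
        countB (fun y => v.mask.testBit y) (suppIdx n z) := by
      rw [hz', countB_suppIdx_comp_symm σ z (fun y => v.mask.testBit y) f hf]
      refine countB_congr _ _ _ fun y hy => ?_
      have hyn := lt_of_mem_suppIdx n z hy
      have : f y = ((σ ⟨y, hyn⟩ : Fin n) : ℕ) := hf ⟨y, hyn⟩
      rw [this]; exact hMinv ⟨y, hyn⟩
    omega
  have htpos : 0 < v.t := lt_of_lt_of_le (List.length_pos_of_mem hbmem) hlen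
  -- (f) the rest of the free support lies in the canonical columns of family `j`
  have hnd : (freeSupp n v.ic.piv z').Nodup := nodup_freeSupp z'
  set S'' := (freeSupp n v.ic.piv z').erase b with hS''
  have hS''sub : S''.Sublist (v.canonCols n j) := by
    have hsub1 : S''.Sublist (List.range n) :=
      ((List.erase_sublist ..).trans List.filter_sublist).trans (suppIdx_sublist_range z')
    have hall : ∀ y ∈ S'', (!(v.ic.piv.elem y) && decide (j ≤ v.orb.getD y 0) && !(y == b)) = true := by
      intro y hy
      have hyne : y ≠ b := fun h => hnd.not_mem_erase (h ▸ hy)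
      have hy' : y ∈ freeSupp n v.ic.piv z' := List.mem_of_mem_erase hy
      have h1 : v.ic.piv.elem y = false := free_of_mem_freeSupp z' hy'
      have h2 : decide (j ≤ v.orb.getD y 0) = true := decide_eq_true (hlab y hy')
      have h3 : (y == b) = false := beq_eq_false_iff_ne.2 hyne
      rw [h1, h2, h3]; rfl
    rw [StabView.canonCols, ← List.filter_eq_self.2 hall]
    exact hsub1.filter _
  -- (g) the word of `z'` = forced row ⊕ the canonical part
  have hsplit : xorList ((freeSupp n v.ic.piv z').map (kerVec v.ic.piv v.ic.red)) =
      v.baseRow j ^^^ xorList (S''.map (kerVec v.ic.piv v.ic.red)) := by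
    rw [xorList_map_filter (kerVec v.ic.piv v.ic.red) (fun y => y == b) (freeSupp n v.ic.piv z')]
    have h1 : (freeSupp n v.ic.piv z').filter (fun y => y == b) = [b] := by
      rw [List.filter_beq, List.count_eq_one_of_mem hnd hbmem, List.replicate_one]
    have h2 : (freeSupp n v.ic.piv z').filter (fun y => !(y == b)) = S'' := by
      rw [hS'', hnd.erase_eq_filter b]; rfl
    rw [h1, h2, List.map_singleton, xorList, xorList, Nat.xor_zero]
    rfl
  -- (h) the verdict of family `j`
  have hrows : (S''.map (kerVec v.ic.piv v.ic.red)).Sublist (v.canonRows n j) := hS''sub.map _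
  obtain ⟨S, hSsub, hSx, hSlen, -, -⟩ := exists_rowPos_sublist (v.canonRows n j) 0 _ hrows
  have hS''len : S''.length ≤ v.t - 1 := by
    rw [hS'', List.length_erase_of_mem hbmem]; omega
  have hleaf := hfam htpos j hj S hSsub (by rw [hSlen, List.length_map]; exact hS''len)
  have hword_lt : xorList ((freeSupp n v.ic.piv z').map (kerVec v.ic.piv v.ic.red)) < 2 ^ n :=
    xorList_lt n _ fun u hu => by
      obtain ⟨y, hy, rfl⟩ := List.mem_map.1 hu
      exact kerVec_lt_two_pow hI'.1 (lt_of_mem_freeSupp z' hy)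
  have hdec := eq_ofBits_freeSupp (Hsyn := Hsyn) hI'.1 hI'.2 hz1'
  have hc : xorSnd S ^^^ v.baseRow j = xorList ((freeSupp n v.ic.piv z').map (kerVec v.ic.piv v.ic.red)) := by
    rw [hsplit, hSx, Nat.xor_comm]
  rw [bzLeaf, hc] at hleaf
  simp only [Bool.or_eq_true, beq_iff_eq] at hleaf
  rcases hleaf with (h0 | hwt) | hmem
  · exfalso
    have hlt := xorFst_lt_of_sublist_rowPos (v.canonRows n j) hSsub
    have hb := congrArg (fun u => u.testBit (v.canonRows n j).length) h0
    simp only [Nat.testBit_xor, Nat.testBit_two_pow_self, Nat.testBit_lt_two_pow hlt, Nat.zero_testBit] at hb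
    simp at hb
  · have := lt_popc_of_wtGt n wmax _ hword_lt hwt
    rw [← hammingNorm_ofBits, ← hdec, hz3'] at this
    exact this
  · exfalso
    apply hz2'
    rw [hdec]
    obtain ⟨e, he, hex⟩ : ∃ e ∈ found, e.1 = xorList ((freeSupp n v.ic.piv z').map (kerVec v.ic.piv v.ic.red)) := by
      simpa [List.mem_map] using List.mem_of_elem_eq_true hmem
    simp only [foundOK, List.all_eq_true, beq_iff_eq] at hfound
    rw [← hex, ← hfound e he]
    exact ofBits_xorRows_mem_rowSpace n Hstab e.2

end Sound

/-! ## Certificate-level wrappers -/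

namespace DistCert

variable (c : DistCert)

/-- `Z` side: a stabilized view's families discharge its `MaskCovers` — FAST structural check. (theorem) -/
theorem maskCoversZ_of_stabF (hs : c.checkStructure = true) {gens : List AutGen}
    (hgens : autGensOKFast c.n c.HX c.HZ gens = true) (v : StabView) (hI : infoSetStructOK c.n c.HX v.ic = true)
    (hv : v.stabOKF c.n (autPerms gens) gens.length = true)
    (hfam : 0 < v.t → ∀ j, j < v.norb →
      TopReaches (bzLeaf (c.dZ - 1) (c.sideZ.found.map Prod.fst)) (v.canonRows c.n j) (v.baseRow j) (v.t - 1)) :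
    MaskCovers c.n c.HX c.HZ (c.dZ - 1) v.mask v.t := by
  have h' := hs
  simp only [checkStructure, Bool.and_eq_true] at h'
  exact maskCovers_of_stabF (comm_of_commOK (c.commOK_of_checkStructure hs)) h'.1.1.2 (autGensOK_of_fast hgens) v hI
    hv hfam

/-- `X` side: a stabilized view's families discharge its `MaskCovers` — FAST structural check (roles of `H^X`, `H^Z`
exchanged). (theorem) -/
theorem maskCoversX_of_stabF (hs : c.checkStructure = true) {gens : List AutGen}
    (hgens : autGensOKFast c.n c.HZ c.HX gens = true) (v : StabView) (hI : infoSetStructOK c.n c.HZ v.ic = true)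
    (hv : v.stabOKF c.n (autPerms gens) gens.length = true)
    (hfam : 0 < v.t → ∀ j, j < v.norb →
      TopReaches (bzLeaf (c.dX - 1) (c.sideX.found.map Prod.fst)) (v.canonRows c.n j) (v.baseRow j) (v.t - 1)) :
    MaskCovers c.n c.HZ c.HX (c.dX - 1) v.mask v.t := by
  have h' := hs
  simp only [checkStructure, Bool.and_eq_true] at h'
  have hcomm := comm_of_commOK (c.commOK_of_checkStructure hs)
  have hcomm' : rowMatrix c.n c.HZ * (rowMatrix c.n c.HX)ᵀ = 0 := by
    rw [← Matrix.transpose_transpose (rowMatrix c.n c.HZ), ← Matrix.transpose_mul, hcomm, Matrix.transpose_zero]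
  exact maskCovers_of_stabF hcomm' h'.2 (autGensOK_of_fast hgens) v hI hv hfam

end DistCert

/-! ## Controls (`[[4,2,2]]`) -/

/-- The fast structural check of the control view `stabC422` passes, and FAILS with a wrong base point (the mover of
`x = 1` would have to map `2^1 ↦ 2^3`). -/
theorem stabC422_okF : stabC422.stabOKF 4 [[1, 2, 3, 0]] 1 = true ∧
    ({ stabC422 with base := [3, 2] } : StabView).stabOKF 4 [[1, 2, 3, 0]] 1 = false := by
  constructor <;> decide

/-- **Control (producer, fast check)**: the stabilized view `stabC422` covers its column set for the `[[4,2,2]]`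
certificate, through `maskCoversZ_of_stabF` — the statement is the landed `maskCovers_certC422_stab`, so this is an
`example` (no restatement). -/
example :
    MaskCovers certC422.n certC422.HX certC422.HZ (certC422.dZ - 1) stabC422.mask stabC422.t :=
  certC422.maskCoversZ_of_stabF checkStructure_certC422 (gens := [⟨[1, 2, 3, 0], [0], [0]⟩]) (by decide)
    stabC422 (by decide) (by decide) fun _ j hj => by
      have hj2 : j < 2 := hj
      interval_cases j
      · exact Plane.topReaches_of_seg 4 1 [] _ _ 0 1 (by decide) (by decide)
      · exact Plane.topReaches_of_seg 4 1 [] _ _ 0 1 (by decide) (by decide)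

end Summit.Ventures.QEC.Census
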